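import Mathlib
import Summits.KontsevichZagierPeriods.Zeta5Search.DenomLaw.LongProfilesPath
import Summits.KontsevichZagierPeriods.Zeta5Search.DenomLaw.Profile18aPath
import Summits.KontsevichZagierPeriods.Zeta5Search.DenomLaw.Profile18bZeroPoint
import HarnessLib

/-!
# ζ(5) search — PATH ACCOUNTING FOR EVERY SORTED PARAMETER VECTOR ON THE FIVE LONGEST FIRST-PERIOD PROFILES, IN ONE STATEMENT (`N_p ≥ 18`)

Cell `pub-zeta5` (HONEST FRAMING: systematic search; no irrationality claim unless certified), TRACK «DENOM-LAW» D1 prover seat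
(denom-prover-d1 g18, `HOME/denom-law/prover-d1/ATTEMPT-18.md` §2).  Gen 17's one-statement assembly `FullProfile.pathAccountingFirstPeriod_long19`
(`DenomLaw/LongProfilesPath`: the node `DenomLaw.PathAccountingFirstPeriod` for every sorted `b` at every first-period prime at which all seven parameters
and at least 19 of the 21 pair blocks reach `p`, full profile up to `d < 4p`) extended by ONE MORE LAYER: the two `N_p = 18` profiles — branch `(1,4)`
(`DenomLaw/Profile18aPath`: THEOREM A‴ at `(8,[1,−5,−5,1])` and the zero-point law) and branch `(2,3)` (`DenomLaw/Profile18bPath` +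
`DenomLaw/Profile18bZeroPoint`: Lemma-D and the zero-point law), both for every sorted `b` with no hypothesis on `d`.  For a sorted vector the pair blocks are
nested (`b₀−b₁−b₂ ≤ b₀−b₁−b₃ ≤ {b₀−b₁−b₄, b₀−b₂−b₃} ≤ …`), so «at least 18 pair blocks reach `p`» reads: `p ≤ b₀ − b₁ − b₅` and (`p ≤ b₀ − b₁ − b₄` or
`p ≤ b₀ − b₂ − b₃`).  **`pathAccountingFirstPeriod_long18`: the node, binders VERBATIM, plus `p ≤ b₇`, `p + b₁ + b₅ ≤ b₀`,
(`p + b₁ + b₄ ≤ b₀ ∨ p + b₂ + b₃ ≤ b₀`) and `d < 4p` (needed on the full profile only: `pathAccounting_long18_short12` drops it once the smallest block is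
short).**  No ray, no family: ten free integers; five general-`b` profile theorems, the landed rungs THEOREM LB / Lemma-D / double drop / A‴ / A⁗′ / L5 and
the type-space laws ORIGIN / ZERO / ZERO-POINT at `M = 8` read on complete machine-generated class-type covers.
MODEL/structure-side valuation bookkeeping of the cell's own rationals; nothing about ζ(5); no γ; records in print UNMOVED.
-/

namespace Summit.KontsevichZagierPeriods.Zeta5Search.FullProfile

open Summit.KontsevichZagierPeriods.Zeta5Search.CasoratianValuation (InPolytope shift casoratian pairFloors refund)
open Summit.KontsevichZagierPeriods.Zeta5Search.WedgeDictionary (dOf)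
open Summit.KontsevichZagierPeriods.Zeta5Search.DenomLaw (cStar FirstPeriod Sorted7)

/-- **`PathAccountingFirstPeriod`'s conclusion for EVERY sorted `b` on the profiles `N_p ≥ 18`, every direction `j`**: all seven parameters reach `p`,
the pair block `b₀ − b₁ − b₅` reaches `p`, at least one of `b₀ − b₁ − b₄`, `b₀ − b₂ − b₃` reaches `p` (first period), and `d(b) < 4p`. -/
theorem pathAccounting_long18 (b : ℕ → ℤ) (j p : ℕ) (hb : InPolytope b) (hs : Sorted7 b) (hbj : InPolytope (shift b j))
    (hj1 : 1 ≤ j) (hj7 : j ≤ 7) (hprime : p.Prime) (hp5 : 5 ≤ p) (hwin : (b 0 + 2 : ℤ) < (p : ℤ) ^ 2) (hfp : FirstPeriod b p)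
    (hP : (p : ℤ) ≤ b 7) (hQ5 : (p : ℤ) + b 1 + b 5 ≤ b 0) (hor : (p : ℤ) + b 1 + b 4 ≤ b 0 ∨ (p : ℤ) + b 2 + b 3 ≤ b 0)
    (hd4 : dOf b < 4 * (p : ℤ)) (hcas : casoratian b j ≠ 0) :
    dOf b / (p : ℤ) - pairFloors b p - min (if 2 ≤ dOf b / (p : ℤ) then (1 : ℤ) else 0) (5 - (cStar b p : ℤ))
      ≤ padicValRat p (casoratian b j) := by
  by_cases h14 : (p : ℤ) + b 1 + b 4 ≤ b 0
  · by_cases h23 : (p : ℤ) + b 2 + b 3 ≤ b 0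
    · exact pathAccounting_long19 b j p hb hs hbj hj1 hj7 hprime hp5 hwin hfp hP h14 h23 hd4 hcas
    · exact pathAccounting_profile18b_all b j p hb hs hbj hj1 hj7 hprime hp5 hwin hfp hP (by linarith) h14 hcas
  · have h23 : (p : ℤ) + b 2 + b 3 ≤ b 0 := hor.resolve_left h14
    exact pathAccounting_profile18a b j p hb hs hbj hj1 hj7 hprime hp5 hwin hfp hP (by linarith) hQ5 h23 hcas

/-- **THE NODE FOR EVERY SORTED `b` ON THE PROFILES `N_p ≥ 18`: `PathAccountingFirstPeriod` with its binders VERBATIM plus `p ≤ b₇`, `p + b₁ + b₅ ≤ b₀`,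
(`p + b₁ + b₄ ≤ b₀ ∨ p + b₂ + b₃ ≤ b₀`) — all parameters and at least eighteen pair blocks reach `p` — and `d(b) < 4p`.** -/
theorem pathAccountingFirstPeriod_long18 :
    ∀ (b : ℕ → ℤ) (p : ℕ), InPolytope b → Sorted7 b → InPolytope (shift b 7) →
      p.Prime → 5 ≤ p → (b 0 + 2 : ℤ) < (p : ℤ) ^ 2 → FirstPeriod b p →
      (p : ℤ) ≤ b 7 → (p : ℤ) + b 1 + b 5 ≤ b 0 → ((p : ℤ) + b 1 + b 4 ≤ b 0 ∨ (p : ℤ) + b 2 + b 3 ≤ b 0) → dOf b < 4 * (p : ℤ) →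
      casoratian b 7 ≠ 0 →
        dOf b / (p : ℤ) - pairFloors b p - min (if 2 ≤ dOf b / (p : ℤ) then (1 : ℤ) else 0) (5 - (cStar b p : ℤ))
          ≤ padicValRat p (casoratian b 7) :=
  fun b p hb hs hb7 hprime hp5 hwin hfp hP hQ5 hor hd4 hcas =>
    pathAccounting_long18 b 7 p hb hs hb7 (by norm_num) (by norm_num) hprime hp5 hwin hfp hP hQ5 hor hd4 hcas

/-- **The same without the `d` hypothesis OFF the full profile**: if the smallest pair block is short (`b₀ < p + b₁ + b₂`), `d < 4p` is automatic. -/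
theorem pathAccounting_long18_short12 (b : ℕ → ℤ) (j p : ℕ) (hb : InPolytope b) (hs : Sorted7 b) (hbj : InPolytope (shift b j))
    (hj1 : 1 ≤ j) (hj7 : j ≤ 7) (hprime : p.Prime) (hp5 : 5 ≤ p) (hwin : (b 0 + 2 : ℤ) < (p : ℤ) ^ 2) (hfp : FirstPeriod b p)
    (hP : (p : ℤ) ≤ b 7) (hQ : b 0 < (p : ℤ) + b 1 + b 2) (hQ5 : (p : ℤ) + b 1 + b 5 ≤ b 0)
    (hor : (p : ℤ) + b 1 + b 4 ≤ b 0 ∨ (p : ℤ) + b 2 + b 3 ≤ b 0) (hcas : casoratian b j ≠ 0) :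
    dOf b / (p : ℤ) - pairFloors b p - min (if 2 ≤ dOf b / (p : ℤ) then (1 : ℤ) else 0) (5 - (cStar b p : ℤ))
      ≤ padicValRat p (casoratian b j) := by
  by_cases h14 : (p : ℤ) + b 1 + b 4 ≤ b 0
  · by_cases h23 : (p : ℤ) + b 2 + b 3 ≤ b 0
    · exact pathAccounting_long19_short12 b j p hb hs hbj hj1 hj7 hprime hp5 hwin hfp hP hQ h14 h23 hcas
    · exact pathAccounting_profile18b_all b j p hb hs hbj hj1 hj7 hprime hp5 hwin hfp hP (by linarith) h14 hcas
  · have h23 : (p : ℤ) + b 2 + b 3 ≤ b 0 := hor.resolve_left h14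
    exact pathAccounting_profile18a b j p hb hs hbj hj1 hj7 hprime hp5 hwin hfp hP (by linarith) hQ5 h23 hcas

end Summit.KontsevichZagierPeriods.Zeta5Search.FullProfile
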